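import Summits.Ventures.HodgeRepro2.T6N41Datum

/-!
# T6N41Place — the local-representation datum of the placement (P7) of N4.1 (Tier 6, M2; definition lane; owner t6-p4)

The residual binder `hunr : ∀ v ∉ D.S, ∀ s, D.Lv v s = D.g₁ v s * D.g₂ v s` of `N41_mainE` / `N4_main` (class AD,
the lead's ruling STATUS l. 4925 (4)(a)) is the unramified identity of TIER5 §N4.1 (P3)+(P7): off the finite set
`S`, the Lapid–Rallis doubling factor `L(s, π_v × χ_{V,v})` is the product of the Euler factors of the two Hecke
characters `η₁′`, `η₂′` of `E`.  The lead's OPTION 1 (STATUS l. 4706 (3)) asks for a separate `N41_placement`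
whose binders are the printed inputs of (P7), each its OWN display over local-representation carriers.

This file holds the CARRIERS (definition lane; no display, no theorem beyond `rfl`-level unfoldings): the objects
Lapid–Rallis §7 and Bump (5.22)–(5.23) speak about, for the datum `D : DoublingLDatum ι` of one cuspidal `π`
(side A: `π₀`; side B: `π₀′`) —
* the prime ideals `𝔓` of `E` above the places `v` of `F` (the `κ`, `b` of the Iwasawa display
  `Hyp.Iwasawa2019_Sec3_1_EulerProductE`), their norms `N 𝔓 > 1`;
* for each `𝔓` the (isomorphism classes of) irreducible admissible representations of `GL₂(E_𝔓)` as an abstract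
  type `RepGL 𝔓`, Bump's nonramified principal series `π(χ₁, χ₂)` with Satake parameters
  `(χ₁(ϖ), χ₂(ϖ)) ∈ ℂˣ × ℂˣ` as the map `ps 𝔓`, and «the local L-function of π» `LGL 𝔓 π` (Bump (5.22));
* LR's `BC(π_v) ⊗ χ_{V,v}` through its `E_𝔓`-components `BCχ 𝔓` (`E_v = ∏_{𝔓 | v} E_𝔓`: ONE component at an inert
  `v`, TWO at a split `v`) and its «usual `GL_N` L-factor» `LGLv v` (LR §7 p. 332 l. 19), the latter BY DEFINITION
  the product of the `E_𝔓`-factors (`LGLv_eq`);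
* the Satake parameters `α 𝔓`, `β 𝔓` of `BCχ 𝔓` at `𝔓 | v ∉ S` (`BCχ_ps`: at `v ∉ S` the representation `π_v` is
  unramified — T3 col. 4 of TIER5 §N4.1, `S` contains every place where `π_v` is ramified — and so is its base
  change, an unramified principal series);
* the values `η₁ 𝔓 = η₁′(𝔓)`, `η₂ 𝔓 = η₂′(𝔓)` of the datum's Hecke characters at `𝔓 ∤ S`, with the datum's
  Euler factors `D.g₁ v`, `D.g₂ v` BY DEFINITION Iwasawa's `∏_{𝔓 | v} (1 − η(𝔓) N(𝔓)^{−s})⁻¹` (`g₁_eq`, `g₂_eq`;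
  the same shape the E display asserts existentially).

The PLACEMENT STATEMENT of (P7) in these words is `PlacementDatum.Satake`: at every `𝔓 | v ∉ S` the Satake
parameters of `BC(π_v) ⊗ χ_{V,v}` are `{η₁′(𝔓), η₂′(𝔓)}` as an unordered pair (Bump p0329: «the order of α₁
and α₂ is irrelevant»).  `T6N41PlaceMain.N41_placement_of_satake` derives `hunr` from it and the two displays
of `T6N41PlaceHyp` (LR §7 / §10, Bump (5.22)); the discharge of `Satake` itself from Harris II (2.2.5)(b) +
Rogawski §11.4 (inert `v`) and Mínguez Thm 1(2) + GR91 (split `v`) is the next layer.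

§8(d): uses an L-value-free non-vanishing device: NO.
-/

namespace Summit.Ventures.HodgeRepro2.T6

/-- The local-representation datum of the placement (P7) over the N4.1 datum `D` (one cuspidal `π` of
`U(W)(𝔸_F)`, `dim_E W = 2`, and the splitting character `χ_V`).  Fields are DATA or definitional links between
the datum's own objects; the printed theorems about them are the displays of `T6N41PlaceHyp.lean`. -/
structure PlacementDatum {ι : Type*} (D : DoublingLDatum ι) where
  /-- the prime ideals `𝔓` of `E` (Iwasawa's 𝔭, the `κ` of the E display) -/
  κ : Type
  /-- the place of `F` below `𝔓` -/
  b : κ → ι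
  /-- finitely many primes of `E` above each place of `F` -/
  fin : ∀ v, (b ⁻¹' {v}).Finite
  /-- `N(𝔓)`, the cardinality of the residue field of `E_𝔓` (Bump's `q` for the local field `E_𝔓`) -/
  N : κ → ℝ
  /-- `N(𝔓) ≥ 2` -/
  one_lt_N : ∀ 𝔓, 1 < N 𝔓
  /-- the irreducible admissible representations of `GL₂(E_𝔓)` (isomorphism classes), abstract -/
  RepGL : κ → Type
  /-- Bump's nonramified principal series `π(χ₁, χ₂)` of `GL₂(E_𝔓)` with Satake parameters
  `α₁ = χ₁(ϖ)`, `α₂ = χ₂(ϖ)` (p0329 ll. 1–5) -/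
  ps : ∀ 𝔓, ℂˣ → ℂˣ → RepGL 𝔓
  /-- «the local L-function of π» (Bump (5.22)) = «the usual `GL_N` L-factor» (LR §7 l. 19), as a function of `s` -/
  LGL : ∀ 𝔓, RepGL 𝔓 → ℂ → ℂ
  /-- the `E_𝔓`-component of LR's `BC(π_v) ⊗ χ_{V,v}` (`v = b 𝔓`; `GL₂(E_v) = ∏_{𝔓 | v} GL₂(E_𝔓)`) -/
  BCχ : ∀ 𝔓, RepGL 𝔓
  /-- `s ↦ L(s, BC(π_v) ⊗ χ_{V,v})`, the usual `GL₂(E_v)` L-factor of LR §7 l. 19 -/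
  LGLv : ι → ℂ → ℂ
  /-- [reading] the `GL₂(E_v)` L-factor over `E_v = ∏_{𝔓 | v} E_𝔓` is the product of the `E_𝔓`-factors of the
  components (one factor at an inert `v`, two at a split `v`) -/
  LGLv_eq : ∀ v, LGLv v = fun s => ∏ 𝔓 ∈ (fin v).toFinset, LGL 𝔓 (BCχ 𝔓) s
  /-- the first Satake parameter of `BCχ 𝔓` -/
  α : κ → ℂˣ
  /-- the second Satake parameter of `BCχ 𝔓` -/
  β : κ → ℂˣ
  /-- [datum] at `𝔓 | v ∉ S` the component `BCχ 𝔓` IS the nonramified principal series with Satake parameters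
  `(α 𝔓, β 𝔓)` (`π_v` unramified at `v ∉ S`, T3 col. 4; Bump p0329 ll. 1–3: every spherical representation of
  `GL₂` that is not one-dimensional is some `π(χ₁, χ₂)` with `χ₁, χ₂` nonramified) -/
  BCχ_ps : ∀ 𝔓, b 𝔓 ∉ D.S → BCχ 𝔓 = ps 𝔓 (α 𝔓) (β 𝔓)
  /-- `η₁′(𝔓)`, the value of the datum's first Hecke character at the prime `𝔓` (`𝔓 ∤ 𝔣`) -/
  η₁ : κ → ℂˣ
  /-- `η₂′(𝔓)` -/
  η₂ : κ → ℂˣ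
  /-- [definitional] the datum's Euler factor of `L_fin(s, η₁′)` at `v ∉ S` is Iwasawa's product of the
  factors `(1 − η₁′(𝔓) N(𝔓)^{−s})⁻¹` over the primes `𝔓 | v` -/
  g₁_eq : ∀ v ∉ D.S, D.g₁ v = fun s : ℂ => ∏ 𝔓 ∈ (fin v).toFinset, (1 - (η₁ 𝔓 : ℂ) * (N 𝔓 : ℂ) ^ (-s))⁻¹
  /-- [definitional] the same for `η₂′` -/
  g₂_eq : ∀ v ∉ D.S, D.g₂ v = fun s : ℂ => ∏ 𝔓 ∈ (fin v).toFinset, (1 - (η₂ 𝔓 : ℂ) * (N 𝔓 : ℂ) ^ (-s))⁻¹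

namespace PlacementDatum

variable {ι : Type*} {D : DoublingLDatum ι} (Pl : PlacementDatum D)

/-- [definition: THE PLACEMENT (P7) in local words — at every prime `𝔓` of `E` above a place `v ∉ S` the Satake
parameters of `BC(π_v) ⊗ χ_{V,v}` are the values `η₁′(𝔓)`, `η₂′(𝔓)` of the two Hecke characters, as an unordered
pair.  TIER5 §N4.1 (P7): at an inert `v ∉ S` both parameters are `1` (Harris II (2.2.5)(b) + Rogawski §11.4 +
the forcing facts F1–F3), at a split `v ∉ S` they are `(μ₂ χ₁, ω μ₂⁻¹ χ₁)` at `𝔓₁` and `(μ₂⁻¹ χ₂, ω⁻¹ μ₂ χ₂)` at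
`𝔓₂` (Mínguez Thm 1(2) + the split dictionary (A″κ), GR91 / Rao).] -/
def Satake : Prop :=
  ∀ 𝔓, Pl.b 𝔓 ∉ D.S →
    (Pl.α 𝔓 = Pl.η₁ 𝔓 ∧ Pl.β 𝔓 = Pl.η₂ 𝔓) ∨ (Pl.α 𝔓 = Pl.η₂ 𝔓 ∧ Pl.β 𝔓 = Pl.η₁ 𝔓)

/-- Bump's factor `(1 − α q^{−s})⁻¹` for one Satake parameter at `𝔓`, as a function of `s`. -/
noncomputable def eulerFactor (𝔓 : Pl.κ) (a : ℂˣ) : ℂ → ℂ :=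
  fun s => (1 - (a : ℂ) * (Pl.N 𝔓 : ℂ) ^ (-s))⁻¹

/-- `eulerFactor` evaluated. -/
theorem eulerFactor_apply (𝔓 : Pl.κ) (a : ℂˣ) (s : ℂ) :
    Pl.eulerFactor 𝔓 a s = (1 - (a : ℂ) * (Pl.N 𝔓 : ℂ) ^ (-s))⁻¹ := rfl

/-- The primes above `v`, as a `Finset`. -/
noncomputable def fiber (v : ι) : Finset Pl.κ := (Pl.fin v).toFinset

/-- Membership in the fibre. -/
theorem mem_fiber {v : ι} {𝔓 : Pl.κ} : 𝔓 ∈ Pl.fiber v ↔ Pl.b 𝔓 = v := by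
  simp [fiber]

end PlacementDatum

end Summit.Ventures.HodgeRepro2.T6
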